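import Literature.NumberTheory.Transcendental.NesterenkoLocalUnmixed
import Literature.RingTheory.MvPolynomial.HomogeneousDimension
import Literature.RingTheory.KrullDimension.AffineCatenary
import Mathlib.RingTheory.Ideal.MinimalPrime.Localization
import Mathlib.RingTheory.Ideal.KrullsHeightTheorem
import Mathlib.RingTheory.RegularLocalRing.Polynomial
import HarnessLib

/-!
# Macaulay's unmixedness theorem at a prime, in the dimension form used by the Ch. 10 toolkit — proofs only

`Literature/NumberTheory/Transcendental/NesterenkoMultiplicityMacaulay.lean` — proofs only (no
definitions, no named facts). The field `macaulay` of the hypothesis bundle `CzToolkit`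
(`NesterenkoMultiplicityToolkit.lean`) asks: for `E_1, …, E_k ∈ 𝔭 ⊂ S = K[x_0, …, x_m]` (`𝔭` prime)
such that every minimal prime `𝔮 ⊆ 𝔭` of `(E)` has `dim S/𝔮 + k = m + 1`, every associated prime
`𝔯 ⊆ 𝔭` of `(E)` is minimal ("all primary components of `(E_0, …, E_n)` inside `𝔭` have the same
dimension", LNM 1752 Ch. 10 proof of Prop. 3.6, p. 159). This file PROVES it over an arbitrary field
`K` (`macaulay_field`; `macaulay_mvPolynomial` for `K[X_0, …, X_{n−1}]`), reducing it to the tree's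
`Nesterenko.mem_minimalPrimes_of_mem_associatedPrimes_of_avoids` (Macaulay at a prime for avoiding
sequences in regular rings, `NesterenkoLocalUnmixed.lean`) through

* `ringKrullDim_quotient_le_add_ncard` — along a minimal prime `P` of `𝔭 + (s)`, `dim S/𝔭 ≤ dim S/P + |s|`
  (Krull's height theorem in the affine domain `S/𝔭` and the dimension formula
  `Literature.RingTheory.KrullDimension.ringKrullDim_quotient_add_height`);
* `avoids_of_ringKrullDim_minimalPrimes` — Matsumura Thm. 17.4 (iii) ⇒ (ii) in the catenary ring `S`:
  the dimension condition on the minimal primes of `(E_1, …, E_k)` inside `𝔭` forces each `E_{i+1}`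
  out of every minimal prime `𝔮 ⊆ 𝔭` of `(E_1, …, E_i)` (a dimension count).

## References

* [Matsumura1987] H. Matsumura, *Commutative Ring Theory*, Thm. 5.6, 13.5, 17.4, 17.6.
* [NesterenkoPhilippon2001] LNM 1752, Ch. 10 §3, proof of Prop. 3.6, condition 3) (pp. 157–159).
-/

noncomputable section

open MvPolynomial

namespace Literature.NumberTheory.Transcendental

namespace NesterenkoMultiplicity

open Literature.RingTheory.MvPolynomial Literature.RingTheory.KrullDimension

section Macaulay

variable {K : Type*} [Field K] {n : ℕ}

/-- **The dimension drops by at most `|s|`** along a minimal prime `P` of `𝔭 + (s)` (`𝔭` prime, `s` finite)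
in `K[X_0, …, X_{n−1}]`: `dim S/𝔭 ≤ dim S/P + |s|` (Krull's height theorem in the affine domain `S/𝔭`
and the dimension formula). [cite: Matsumura1987, Thm. 13.5 and Thm. 5.6] -/
theorem ringKrullDim_quotient_le_add_ncard {𝔭 P : Ideal (MvPolynomial (Fin n) K)} [𝔭.IsPrime]
    {s : Set (MvPolynomial (Fin n) K)} (hs : s.Finite) (hP : P ∈ (𝔭 ⊔ Ideal.span s).minimalPrimes) :
    ringKrullDim (MvPolynomial (Fin n) K ⧸ 𝔭) ≤ ringKrullDim (MvPolynomial (Fin n) K ⧸ P) + s.ncard := by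
  set A := MvPolynomial (Fin n) K ⧸ 𝔭 with hA
  haveI : Algebra.FiniteType K A :=
    Algebra.FiniteType.of_surjective (Ideal.Quotient.mkₐ K 𝔭) (Ideal.Quotient.mkₐ_surjective K 𝔭)
  have h𝔭P : 𝔭 ≤ P := le_sup_left.trans hP.1.2
  haveI hPprime : P.IsPrime := hP.1.1
  set Pbar : Ideal A := P.map (Ideal.Quotient.mk 𝔭) with hPbar
  haveI : Pbar.IsPrime := Ideal.isPrime_map_quotientMk_of_isPrime h𝔭P
  have hPbar_min : Pbar ∈ ((Ideal.span s).map (Ideal.Quotient.mk 𝔭)).minimalPrimes := by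
    rw [Ideal.minimalPrimes_map_of_surjective Ideal.Quotient.mk_surjective, Ideal.mk_ker, sup_comm]
    exact ⟨P, hP, rfl⟩
  have hht : Pbar.height ≤ (s.ncard : ℕ∞) := by
    rw [Ideal.map_span] at hPbar_min
    exact (Ideal.height_le_card_of_mem_minimalPrimes_span (hs.image _) hPbar_min).trans
      (by exact_mod_cast Set.ncard_image_le hs)
  have hcat := ringKrullDim_quotient_add_height (F := K) Pbar
  have e : A ⧸ Pbar ≃+* MvPolynomial (Fin n) K ⧸ P := DoubleQuot.quotQuotEquivQuotOfLE h𝔭P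
  rw [ringKrullDim_eq_of_ringEquiv e] at hcat
  rw [← hcat]
  have : ((Pbar.height : ℕ∞) : WithBot ℕ∞) ≤ ((s.ncard : ℕ∞) : WithBot ℕ∞) := WithBot.coe_le_coe.mpr hht
  exact add_le_add_right (by simpa using this) _

/-- The ideal of a list is the span of its range. [folklore] -/
theorem ofList_ofFn {R : Type*} [CommRing R] {k : ℕ} (E : Fin k → R) :
    Ideal.ofList (List.ofFn E) = Ideal.span (Set.range E) := by
  unfold Ideal.ofList
  congr 1
  ext x
  simp [List.mem_ofFn']

/-- `ht 𝔮 ≤ |L|` for a minimal prime of the ideal of a list (Krull). [folklore] -/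
theorem height_le_length_of_mem_minimalPrimes_ofList {R : Type*} [CommRing R] [IsNoetherianRing R]
    {L : List R} {𝔮 : Ideal R} (h𝔮 : 𝔮 ∈ (Ideal.ofList L).minimalPrimes) : 𝔮.height ≤ L.length := by
  classical
  have hs : ({x | x ∈ L} : Set R).Finite := L.finite_toSet
  refine (Ideal.height_le_card_of_mem_minimalPrimes_span hs h𝔮).trans ?_
  have : ({x | x ∈ L} : Set R) = ↑L.toFinset := by ext; simp
  rw [this, Set.ncard_coe_finset]
  exact_mod_cast L.toFinset_card_le

/-- **From the dimension condition to an avoiding sequence** (Matsumura Thm. 17.4 (iii) ⇒ (ii), in the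
catenary ring `K[X_0, …, X_{n−1}]`): if every minimal prime `𝔮 ⊆ 𝔭` of `(E_1, …, E_k)` has
`dim S/𝔮 = n − k`, then each `E_{i+1}` lies outside every minimal prime `𝔮 ⊆ 𝔭` of `(E_1, …, E_i)`.
[cite: Matsumura1987, Thm. 17.4] -/
theorem avoids_of_ringKrullDim_minimalPrimes {k : ℕ} (E : Fin k → MvPolynomial (Fin n) K)
    {𝔭 : Ideal (MvPolynomial (Fin n) K)} [𝔭.IsPrime] (hE : Ideal.span (Set.range E) ≤ 𝔭)
    (hdim : ∀ 𝔮 ∈ (Ideal.span (Set.range E)).minimalPrimes, 𝔮 ≤ 𝔭 →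
      ringKrullDim (MvPolynomial (Fin n) K ⧸ 𝔮) + k = (n : WithBot ℕ∞)) :
    ∀ (L₁ : List (MvPolynomial (Fin n) K)) (e : MvPolynomial (Fin n) K) (L₂ : List (MvPolynomial (Fin n) K)),
      List.ofFn E = L₁ ++ e :: L₂ →
      ∀ 𝔮 ∈ (Ideal.ofList L₁).minimalPrimes, 𝔮 ≤ 𝔭 → e ∉ 𝔮 := by
  intro L₁ e L₂ hsplit 𝔮 h𝔮 h𝔮𝔭 he
  haveI h𝔮p : 𝔮.IsPrime := h𝔮.1.1
  have hlen : L₁.length + 1 + L₂.length = k := by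
    have := congrArg List.length hsplit
    simp only [List.length_ofFn, List.length_append, List.length_cons] at this
    omega
  -- membership of the pieces
  have hmemE : ∀ x, x ∈ List.ofFn E → x ∈ Ideal.span (Set.range E) := fun x hx => by
    obtain ⟨i, rfl⟩ := (List.mem_ofFn' E x).mp hx
    exact Ideal.subset_span ⟨i, rfl⟩
  have hL₂𝔭 : Ideal.ofList L₂ ≤ 𝔭 := by
    unfold Ideal.ofList
    rw [Ideal.span_le]
    intro x hx
    exact hE (hmemE x (by rw [hsplit]; exact List.mem_append_right _ (List.mem_cons_of_mem _ hx)))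
  -- a minimal prime `Q'` of `𝔮 + (L₂)` inside `𝔭`, and a minimal prime `Q''` of `(E)` inside `Q'`
  obtain ⟨Q', hQ', hQ'𝔭⟩ := Ideal.exists_minimalPrimes_le (sup_le h𝔮𝔭 hL₂𝔭 : 𝔮 ⊔ Ideal.ofList L₂ ≤ 𝔭)
  haveI hQ'p : Q'.IsPrime := hQ'.1.1
  have hEQ' : Ideal.span (Set.range E) ≤ Q' := by
    rw [Ideal.span_le]
    rintro x ⟨i, rfl⟩
    have hx : E i ∈ List.ofFn E := (List.mem_ofFn' E _).mpr ⟨i, rfl⟩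
    rw [hsplit, List.mem_append, List.mem_cons] at hx
    rcases hx with hx | rfl | hx
    · exact hQ'.1.2 (Ideal.mem_sup_left (h𝔮.1.2 (Ideal.subset_span hx)))
    · exact hQ'.1.2 (Ideal.mem_sup_left he)
    · exact hQ'.1.2 (Ideal.mem_sup_right (Ideal.subset_span hx))
  obtain ⟨Q'', hQ'', hQ''Q'⟩ := Ideal.exists_minimalPrimes_le hEQ'
  -- the dimension count
  have hdQ'' := hdim Q'' hQ'' (hQ''Q'.trans hQ'𝔭)
  have h1 : ringKrullDim (MvPolynomial (Fin n) K ⧸ Q') ≤ ringKrullDim (MvPolynomial (Fin n) K ⧸ Q'') :=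
    ringKrullDim_le_of_surjective (Ideal.Quotient.factor hQ''Q') (Ideal.Quotient.factor_surjective hQ''Q')
  have h2 : ringKrullDim (MvPolynomial (Fin n) K ⧸ 𝔮) ≤
      ringKrullDim (MvPolynomial (Fin n) K ⧸ Q') + ({x | x ∈ L₂} : Set _).ncard :=
    ringKrullDim_quotient_le_add_ncard L₂.finite_toSet hQ'
  have hncard : ({x | x ∈ L₂} : Set (MvPolynomial (Fin n) K)).ncard ≤ L₂.length := by
    classical
    have : ({x | x ∈ L₂} : Set (MvPolynomial (Fin n) K)) = ↑L₂.toFinset := by ext; simp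
    rw [this, Set.ncard_coe_finset]
    exact L₂.toFinset_card_le
  have h3 := ringKrullDim_quotient_add_height (F := K) 𝔮
  rw [ringKrullDim_mvPolynomial_fin (K := K) n] at h3
  have hht𝔮 := height_le_length_of_mem_minimalPrimes_ofList h𝔮
  -- pass to natural numbers
  obtain ⟨a, ha, -⟩ := exists_nat_ringKrullDim_quotient_eq (K := K) h𝔮p.ne_top
  obtain ⟨b, hb, -⟩ := exists_nat_ringKrullDim_quotient_eq (K := K) hQ'p.ne_top
  obtain ⟨c, hc, -⟩ := exists_nat_ringKrullDim_quotient_eq (K := K) hQ''.1.1.ne_top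
  obtain ⟨h, hh⟩ : ∃ h : ℕ, 𝔮.height = h :=
    ENat.ne_top_iff_exists.mp (ne_top_of_le_ne_top (ENat.coe_ne_top _) hht𝔮) |>.imp fun _ h => h.symm
  rw [ha, hh] at h3
  rw [hc] at hdQ''
  rw [ha, hb] at h2
  rw [hb, hc] at h1
  rw [hh] at hht𝔮
  have e3 : a + h = n := by exact_mod_cast h3
  have eQ : c + k = n := by exact_mod_cast hdQ''
  have e1 : b ≤ c := by exact_mod_cast h1
  have e2 : a ≤ b + ({x | x ∈ L₂} : Set (MvPolynomial (Fin n) K)).ncard := by exact_mod_cast h2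
  have e4 : h ≤ L₁.length := by exact_mod_cast hht𝔮
  omega

/-- **Macaulay's unmixedness theorem at a prime, in the form of the toolkit field `CzToolkit.macaulay`**
(over any field `K`): if every minimal prime `𝔮 ⊆ 𝔭` of `(E_1, …, E_k) ⊆ 𝔭` has `dim S/𝔮 + k = n`, then
every associated prime `𝔯 ⊆ 𝔭` of `(E_1, …, E_k)` is minimal. Proof: the dimension condition makes
`E` an avoiding sequence at `𝔭` (`avoids_of_ringKrullDim_minimalPrimes`), and the tree's
`Nesterenko.mem_minimalPrimes_of_mem_associatedPrimes_of_avoids` (regular ring `K[X̲]`, localisation at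
`𝔭`, Cohen–Macaulay) applies. [cite: Matsumura1987, Thm. 17.4 and Thm. 17.6] -/
theorem macaulay_mvPolynomial {k : ℕ} (E : Fin k → MvPolynomial (Fin n) K)
    (𝔭 : Ideal (MvPolynomial (Fin n) K)) (h𝔭 : 𝔭.IsPrime) (hE : Ideal.span (Set.range E) ≤ 𝔭)
    (hdim : ∀ 𝔮 ∈ (Ideal.span (Set.range E)).minimalPrimes, 𝔮 ≤ 𝔭 →
      ringKrullDim (MvPolynomial (Fin n) K ⧸ 𝔮) + k = (n : WithBot ℕ∞)) :
    ∀ 𝔯 ∈ (Ideal.span (Set.range E)).associatedPrimes, 𝔯 ≤ 𝔭 →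
      𝔯 ∈ (Ideal.span (Set.range E)).minimalPrimes := by
  intro 𝔯 h𝔯 h𝔯𝔭
  haveI := h𝔭
  rw [← ofList_ofFn] at h𝔯 ⊢
  have hE𝔭 : ∀ e ∈ List.ofFn E, e ∈ 𝔭 := fun e he => by
    obtain ⟨i, rfl⟩ := (List.mem_ofFn' E e).mp he
    exact hE (Ideal.subset_span ⟨i, rfl⟩)
  have h𝔯' := (Nesterenko.mem_associatedPrimes_quotient_iff _ _).mpr h𝔯
  exact Nesterenko.mem_minimalPrimes_of_mem_associatedPrimes_of_avoids 𝔭 hE𝔭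
    (avoids_of_ringKrullDim_minimalPrimes E hE hdim) h𝔯' h𝔯𝔭

/-- **The toolkit field `CzToolkit.macaulay`, discharged over any field** (`S = K[x_0, …, x_m]`):
the statement of `NesterenkoMultiplicityToolkit.CzToolkit.macaulay` with `RatFunc ℂ` replaced by an
arbitrary field `K`. [cite: Matsumura1987, Thm. 17.4 and Thm. 17.6] -/
theorem macaulay_field (K : Type*) [Field K] (m : ℕ) :
    ∀ (k : ℕ) (E : Fin k → MvPolynomial (Fin (m + 1)) K) (𝔭 : Ideal (MvPolynomial (Fin (m + 1)) K)),
      𝔭.IsPrime → Ideal.span (Set.range E) ≤ 𝔭 →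
      (∀ 𝔮 ∈ (Ideal.span (Set.range E)).minimalPrimes, 𝔮 ≤ 𝔭 →
        ringKrullDim (MvPolynomial (Fin (m + 1)) K ⧸ 𝔮) + k = (m : WithBot ℕ∞) + 1) →
      ∀ 𝔯 ∈ (Ideal.span (Set.range E)).associatedPrimes, 𝔯 ≤ 𝔭 →
        𝔯 ∈ (Ideal.span (Set.range E)).minimalPrimes := by
  intro k E 𝔭 h𝔭 hE hdim
  refine macaulay_mvPolynomial E 𝔭 h𝔭 hE fun 𝔮 h𝔮 h𝔮𝔭 => ?_
  rw [hdim 𝔮 h𝔮 h𝔮𝔭]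
  push_cast; rfl

end Macaulay

end NesterenkoMultiplicity

end Literature.NumberTheory.Transcendental
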